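import Literature.Computability.Cryptography.RegevReductionCVPSplit
import Literature.Algebra.EuclideanLattices.RegevDigitRounds
import Literature.Algebra.EuclideanLattices.BabaiFarnessCertificate
import HarnessLib

/-!
# Regev 2009, Lemma 3.5 — the exact arithmetic of the lift `CVP^{(q)} ⇒ CVP_{L*, d}`: back-substitution and the nearest-plane finish

Literature first-formalisation unit `b2b-lwe-3` (generation 6, second module), bundle
`papers/QuantumAdvantage/lwe-quantum-autopsy/`.  THE VALUE of this file is a THEOREM about a KNOWN
reduction (O. Regev, *On lattices, learning with errors, random linear codes, and cryptography*, J. ACM 56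
(2009), Lemma 3.5) — NOT progress on any open problem and NOT summit progress.

## What this file proves (theorems only; no definition, no named fact, no `sorry`)

`RegevReductionCVPSplit.lean` split the residual `A_cvp` of Regev's main procedure into the digit family
`A_cvpq := regev2009_lemma_3_11_cvpqFamily` and the lift `A_lift := regev2009_lemma_3_5_liftFamily`, and
proved the INVARIANT of Lemma 3.5's recursion (`DigitOracle.iter_admissible`: every true iterate
`x_i = DigitOracle.iter q I t i` keeps a unique close dual vector, at distance `≤ d/qⁱ`).  This file proves
the remaining MATHEMATICS of Lemma 3.5 — everything a prover of `A_lift` needs about the classical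
post-processing of the lift `R`, on exact (rational) data; what it does not contain is the circuit family
`R` itself and the union bound over the digit solver's internal randomness (see "Not here").

* `DigitOracle.mul_coords_next_add_digits` — ONE STEP OF BACK-SUBSTITUTION (Regev, proof of Lemma 3.5:
  "`a_{i+1} = (a_i − (a_i mod p))/p`"): for admissible `t` at distance `d < λ₁(L(B)*)/2`,
  `q · a(x_{i+1})_j + (a(x_i) mod q)_j = a(x_i)_j`, where `a(x) = CVPOracle.coords I x ∈ ℤⁿ` is the
  coordinate vector (in the dual basis `B^∨`) of the dual lattice point close to `x` and
  `(a(x_i) mod q) = DigitOracle.digits`.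
* `DigitOracle.coords_eq_pow_mul_coords_iter_add_sum` — BACK-SUBSTITUTION OVER `N` ROUNDS:
  `a(x)_j = q^N · a(x_N)_j + Σ_{i<N} qⁱ · (a(x_i) mod q)_j`.
* `DigitOracle.div_pow_lt_half_norm_gramSchmidt_dual_rev` — WHY `2n` ROUNDS (Regev: "`2ⁿ d/pⁿ ≤ d <
  λ₁(L)/2`", with Claim 2.13 = LLL + Babai): `d/q^{2n} < ‖b̃'ᵢ‖/2` for every Gram–Schmidt vector of the
  reversed dual `(b'^∨_n, …, b'^∨_1)` of an LLL-reduced basis `b'` of `L(B)` (`q ≥ 2`; the tree's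
  `Regev2009.norm_div_pow_lt_gramSchmidt_dual_rev`, transported to `L(B)` and to the distance `d`).
* `DigitOracle.norm_iter_sub_vecOf_nearestPlane_le`, `DigitOracle.coords_iter_eq_repr_nearestPlane` — THE
  FINISH IS EXACT (Babai 1986 §3, the tree's `Babai.vecOf_nearestPlane_eq_of_norm_sub_lt`): for any family
  `f` whose `ℤ`-span is `L(B)*` and whose Gram–Schmidt norms are `≥ 2R > 2d/q^N`, nearest-plane rounding
  of `x_N` in `f` returns the close dual vector of `x_N`, so `a(x_N) = (B^∨)^{-1} · NearestPlane_f(x_N)`.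
* `DigitOracle.coords_eq_of_nearestPlane` — LEMMA 3.5's OUTPUT FORMULA:
  `a(x)_j = q^N · ((B^∨)^{-1} NearestPlane_f(x_N))_j + Σ_{i<N} qⁱ (a(x_i) mod q)_j`.
* `DigitOracle.span_dualVec_rev_eq`, `DigitOracle.vecOf_nearestPlane_dualVec_rev_mem`,
  `DigitOracle.div_pow_lt_half_norm_gramSchmidt_dualVec_rev`, `DigitOracle.coords_eq_of_isLLLReduced` —
  the same PACKAGED for the concrete finish a machine would run: `B'` an LLL-reduced integer basis of
  `L(B)` (as produced by the tree's LLL machine, `exists_lllMachineF_encode_eq` /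
  `LatticeInstance.lllReduce`), `f = (b'^∨_n, …, b'^∨_1)` its reversed dual basis
  (`Peikert2009.dualVec ⟨n, B'⟩ ∘ Fin.rev`), `N = 2n` rounds, no side condition left except `q ≥ 2`,
  admissibility and `d < λ₁(L(B)*)/2` — exactly the hypotheses under which `A_lift` is invoked.

## How a prover of `A_lift` uses this

The lift `R` of `A_lift` parses the query code `c`, sets `x := DigitOracle.ratOf c` (so
`DigitOracle.point I x = CVPOracle.point I c`, `DigitOracle.point_ratOf`), and for `i < 2n` calls the
digit solver `T` on the code of `x̃_i` (with `x̃_0 = x`), reads `T`'s answer table as a CLAIMED digit vector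
`r̃_i ∈ {0,…,q−1}ⁿ` and sets `x̃_{i+1} := (x̃_i − r̃_i)/q` coordinatewise; finally it LLL-reduces `B`, runs
Babai's nearest plane for `x̃_{2n}` in the reversed dual of the reduced basis, converts the output to
`B^∨`-coordinates `ã`, and writes the offset-binary table of `q^{2n} ã + Σ_{i<2n} qⁱ r̃_i`.  ON THE GOOD
PATH — every call of `T` answered with the true table `DigitOracle.answerTable q I x̃_i` — one has
`r̃_i = digits q I x_i` and `x̃_i = x_i` for all `i` (induction on `i`, `DigitOracle.next`), hence by
`coords_eq_of_isLLLReduced` the written table is `CVPOracle.answerTable I c`: `R` is correct.  The event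
"not the good path" is contained in the union over `i < 2n` of "`T` errs on the TRUE iterate `x_i`" (the
first wrong answer is given on a true iterate), whose probability is `Σ_{i<2n} DigitOracle.failProb T q I ρ
k y (iter q I (ratOf c) i)` — the right-hand side of `A_lift` with `C = 1`, `p_R = 2n`, `ν = 0`.

## Not here (what still separates this file from a proof of `A_lift`)

(i) the uniform family `R` as a `UniformQCircuitFamily` built from `T` with the tree's classical-wrap /
chain idiom (`QuantumComplexity/CWrapFamily.lean`, `SeqChain*.lean`, `ChainCompose*.lean`), including the
exact-rational classical blocks (parse, `next`, LLL, Gram–Schmidt over `ℚ`, nearest plane, change of basis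
to `B^∨`, offset-binary output) as reversible classical circuits of polynomial size; (ii) the union bound
over `T`'s measurement outcomes along the chain (a statement about `UniformQCircuitFamily.outputDistribution`
of the composed family); (iii) the polynomial `p_R` and negligible `ν` bookkeeping.  None of these is
mathematics of lattices; all of it is machine semantics.

## References

* O. Regev, *On lattices, learning with errors, random linear codes, and cryptography*, J. ACM 56(6)
  (2009), Lemma 3.5 (p. 16 of the author's version arXiv:2401.03703), Claim 2.13 (p. 14). [Regev2009]
  [RegevLWE2009]
* L. Babai, *On Lovász' lattice reduction and the nearest lattice point problem*, Combinatorica 6 (1986),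
  §3. [Babai1986]
* A. K. Lenstra, H. W. Lenstra, L. Lovász, *Factoring polynomials with rational coefficients*, Math. Ann.
  261 (1982), Prop. 1.12. [LenstraLenstraLovasz1982]
* C. Peikert, *Public-key cryptosystems from the worst-case shortest vector problem*, STOC 2009 (full
  version), §2.1 and Lemma 2.3. [Peikert2009]
-/

noncomputable section

namespace Literature.Computability.Cryptography

open Filter _root_.Computability Literature.Computability.Complexity
  Literature.Algebra.EuclideanLattices Literature.Computability.QuantumComplexity
  Literature.Computability.Cryptography.LWE
open scoped ENNReal

namespace Regev2009

namespace DigitOracle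

open Brick Literature.Computability.Cryptography.Peikert2009 GPVSampler Babai InnerProductSpace
open scoped InnerProductSpace RealInnerProductSpace

variable (q : ℕ) [NeZero q] (I : LatticeInstance)

/-! ### Back-substitution: `a_i = q · a_{i+1} + (a_i mod q)` -/

/-- **One step of the back-substitution** (Regev, proof of Lemma 3.5: "`a_{i+1} = (a_i − (a_i mod p))/p`"):
on admissible data the dual coordinates of the close vector of `x_i` are `q` times those of the close
vector of `x_{i+1}` plus the digit vector. [cite: Regev2009, Lemma 3.5 (proof)] -/
theorem mul_coords_next_add_digits [IsZLattice ℝ I.lattice] {t : Fin I.n → ℚ} {d : ℝ}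
    (hd : d < minNorm (dualLattice I.lattice) / 2) (ht : Admissible I d t) (j : Fin I.n) :
    (q : ℤ) * CVPOracle.coords I (point I (next q I t)) j + digits q I t j =
      CVPOracle.coords I (point I t) j := by
  obtain ⟨v, hv, hdist⟩ := ht
  set b := dualZBasis I
  set κ : dualLattice I.lattice := ⟨v, hv⟩
  have hlt : ‖point I t - (κ : EuclideanSpace ℝ (Fin I.n))‖ < minNorm (dualLattice I.lattice) / 2 :=
    hdist.trans_lt hd
  have hco : CVPOracle.coords I (point I t) = fun j => b.repr κ j := CVPOracle.coords_eq_repr I κ hlt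
  set r : Fin I.n → ℤ := fun j => (digits q I t j : ℤ)
  have hr : ∀ j, (q : ℤ) ∣ b.repr κ j - r j := fun j => by
    have h := Literature.Algebra.EuclideanLattices.Regev2009.dvd_repr_sub_val b q κ j
    have hrj : r j = (((b.repr κ j : ZMod q)).val : ℤ) := by
      simp only [r, digits, hco]
    rwa [hrj]
  set κ₁ : dualLattice I.lattice := b.equivFun.symm fun j => (b.repr κ j - r j) / q
  have hq1 : (1 : ℝ) ≤ q := Nat.one_le_cast.2 (Nat.pos_of_ne_zero (NeZero.ne q))
  have hnorm : ‖point I (next q I t) - (κ₁ : EuclideanSpace ℝ (Fin I.n))‖ =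
      ‖point I t - (κ : EuclideanSpace ℝ (Fin I.n))‖ / q := by
    rw [point_next q I t]
    exact Literature.Algebra.EuclideanLattices.Regev2009.norm_inv_smul_sub_sub_eq b q (point I t) κ r hr
  have hlt₁ : ‖point I (next q I t) - (κ₁ : EuclideanSpace ℝ (Fin I.n))‖ <
      minNorm (dualLattice I.lattice) / 2 := by
    rw [hnorm]
    exact (div_le_self (norm_nonneg _) hq1).trans_lt hlt
  have hco₁ : CVPOracle.coords I (point I (next q I t)) = fun j => b.repr κ₁ j :=
    CVPOracle.coords_eq_repr I κ₁ hlt₁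
  have hrepr₁ : b.repr κ₁ j = (b.repr κ j - r j) / q := by
    simp only [κ₁]
    rw [← Module.Basis.equivFun_apply, LinearEquiv.apply_symm_apply]
  rw [hco, hco₁]
  dsimp only
  rw [hrepr₁, Int.mul_ediv_cancel' (hr j)]
  simp only [r, sub_add_cancel]

/-- **Back-substitution over `N` rounds** (Regev: the output `a_1` is recovered from `a_{N+1}` and the
digits): `a(x) = q^N · a(x_N) + Σ_{i<N} qⁱ · (a(x_i) mod q)` coordinatewise, for admissible data.
[cite: Regev2009, Lemma 3.5 (proof)] -/
theorem coords_eq_pow_mul_coords_iter_add_sum [IsZLattice ℝ I.lattice] {t : Fin I.n → ℚ} {d : ℝ}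
    (hd : d < minNorm (dualLattice I.lattice) / 2) (ht : Admissible I d t) (j : Fin I.n) (N : ℕ) :
    CVPOracle.coords I (point I t) j =
      (q : ℤ) ^ N * CVPOracle.coords I (point I (iter q I t N)) j +
        ∑ i ∈ Finset.range N, (q : ℤ) ^ i * (digits q I (iter q I t i) j : ℤ) := by
  induction N with
  | zero => simp
  | succ N ih =>
    have hN : Admissible I d (iter q I t N) :=
      iter_admissible q I (isNonsingular_of_isZLattice I) hd ht N
    have hstep := mul_coords_next_add_digits q I hd hN j
    rw [← iter_succ] at hstep
    rw [ih, Finset.sum_range_succ, pow_succ, ← hstep]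
    ring

/-! ### The finish: after `2n` rounds Babai's nearest plane on a reduced dual basis is exact -/

omit [NeZero q] in
/-- **Why `2n` rounds suffice** (Regev: "`2ⁿ d/pⁿ ≤ d < λ₁(L)/2` … such as Babai's nearest plane
algorithm"): if `d < λ₁(L*)/2` then `d/q^{2n}` is below half of EVERY Gram–Schmidt norm of the reversed
dual `(b^∨_n, …, b^∨_1)` of an LLL-reduced basis `b` of `L(B)` (`q ≥ 2`).
[cite: Regev2009, Lemma 3.5 (proof) with Claim 2.13; LenstraLenstraLovasz1982, Prop. 1.12; Peikert2009, Lemma 2.3] -/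
theorem div_pow_lt_half_norm_gramSchmidt_dual_rev (b : Module.Basis (Fin I.n) ℝ (EuclideanSpace ℝ (Fin I.n)))
    (hbI : latticeOfBasis b = I.lattice) (hred : IsLLLReduced (3 / 4) ⇑b)
    (b' : Module.Basis (Fin I.n) ℝ (EuclideanSpace ℝ (Fin I.n)))
    (hbd : ∀ i j, ⟪b i, b' j⟫_ℝ = if i = j then (1 : ℝ) else 0) (hq : 2 ≤ q)
    {d : ℝ} (hd0 : 0 ≤ d) (hd : d < minNorm (dualLattice I.lattice) / 2) (i : Fin I.n) :
    d / (q : ℝ) ^ (2 * I.n) < ‖gramSchmidt ℝ (⇑b' ∘ Fin.rev) i‖ / 2 := by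
  set x : EuclideanSpace ℝ (Fin I.n) := d • EuclideanSpace.single i (1 : ℝ)
  have hx : ‖x - 0‖ = d := by
    simp [x, norm_smul, abs_of_nonneg hd0]
  have hx' : ‖x - 0‖ < minNorm (dualLattice (latticeOfBasis b)) / 2 := by rw [hx, hbI]; exact hd
  have h := Literature.Algebra.EuclideanLattices.Regev2009.norm_div_pow_lt_gramSchmidt_dual_rev b hred b' hbd
    hx' hq i
  rwa [hx] at h

/-- **Babai's nearest plane recovers the close vector of the last iterate**: if the `ℤ`-span of the
family `f` is `L(B)*` and every Gram–Schmidt vector of `f` has norm `≥ 2R > 2d/q^N`, then nearest-plane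
rounding of `x_N` in the basis `f` returns a point of `L(B)*` within `d/q^N` of `x_N` (namely
`κ_{L*}(x_N)`). [cite: Babai1986, §3; Regev2009, Lemma 3.5 (proof)] -/
theorem norm_iter_sub_vecOf_nearestPlane_le [IsZLattice ℝ I.lattice]
    {f : Fin I.n → EuclideanSpace ℝ (Fin I.n)} (hf : Submodule.span ℤ (Set.range f) = dualLattice I.lattice)
    {R : ℝ} (hgs : ∀ i, 2 * R ≤ ‖gramSchmidt ℝ f i‖) {t : Fin I.n → ℚ} {d : ℝ}
    (hd : d < minNorm (dualLattice I.lattice) / 2) (ht : Admissible I d t) {N : ℕ}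
    (hR : d / (q : ℝ) ^ N < R) :
    vecOf f (nearestPlane I.n f (point I (iter q I t N))) ∈ dualLattice I.lattice ∧
      ‖point I (iter q I t N) - vecOf f (nearestPlane I.n f (point I (iter q I t N)))‖ ≤ d / (q : ℝ) ^ N := by
  obtain ⟨v, hv, hdist⟩ := exists_near_iter q I (isNonsingular_of_isZLattice I) hd ht N
  have hvf : v ∈ Submodule.span ℤ (Set.range f) := by rw [hf]; exact hv
  have heq : vecOf f (nearestPlane I.n f (point I (iter q I t N))) = v :=
    vecOf_nearestPlane_eq_of_norm_sub_lt f hgs hvf (hdist.trans_lt hR)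
  rw [heq]
  exact ⟨hv, hdist⟩

/-- **The dual coordinates of the last iterate are read off Babai's output**: under the hypotheses of
`norm_iter_sub_vecOf_nearestPlane_le`, `a(x_N) = (B^∨)^{-1} · NearestPlane_f(x_N)`.
[cite: Babai1986, §3; Regev2009, Lemma 3.5 (proof)] -/
theorem coords_iter_eq_repr_nearestPlane [IsZLattice ℝ I.lattice]
    {f : Fin I.n → EuclideanSpace ℝ (Fin I.n)} (hf : Submodule.span ℤ (Set.range f) = dualLattice I.lattice)
    {R : ℝ} (hgs : ∀ i, 2 * R ≤ ‖gramSchmidt ℝ f i‖) {t : Fin I.n → ℚ} {d : ℝ}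
    (hd : d < minNorm (dualLattice I.lattice) / 2) (ht : Admissible I d t) {N : ℕ}
    (hR : d / (q : ℝ) ^ N < R) :
    CVPOracle.coords I (point I (iter q I t N)) = fun j =>
      (dualZBasis I).repr ⟨vecOf f (nearestPlane I.n f (point I (iter q I t N))),
        (norm_iter_sub_vecOf_nearestPlane_le q I hf hgs hd ht hR).1⟩ j := by
  have h := norm_iter_sub_vecOf_nearestPlane_le q I hf hgs hd ht hR
  have hq1 : (1 : ℝ) ≤ q := Nat.one_le_cast.2 (Nat.pos_of_ne_zero (NeZero.ne q))
  refine CVPOracle.coords_eq_repr I ⟨_, h.1⟩ (h.2.trans_lt ?_)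
  exact (div_le_self ht.nonneg (one_le_pow₀ hq1)).trans_lt hd

/-- **The whole lift on exact data** (Lemma 3.5's output formula): with `f`, `R` as above and `N` rounds,
`a(x) = q^N · (B^∨)^{-1} NearestPlane_f(x_N) + Σ_{i<N} qⁱ (a(x_i) mod q)`. [cite: Regev2009, Lemma 3.5 (proof); Babai1986, §3] -/
theorem coords_eq_of_nearestPlane [IsZLattice ℝ I.lattice]
    {f : Fin I.n → EuclideanSpace ℝ (Fin I.n)} (hf : Submodule.span ℤ (Set.range f) = dualLattice I.lattice)
    {R : ℝ} (hgs : ∀ i, 2 * R ≤ ‖gramSchmidt ℝ f i‖) {t : Fin I.n → ℚ} {d : ℝ}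
    (hd : d < minNorm (dualLattice I.lattice) / 2) (ht : Admissible I d t) {N : ℕ}
    (hR : d / (q : ℝ) ^ N < R) (j : Fin I.n) :
    CVPOracle.coords I (point I t) j =
      (q : ℤ) ^ N * (dualZBasis I).repr ⟨vecOf f (nearestPlane I.n f (point I (iter q I t N))),
        (norm_iter_sub_vecOf_nearestPlane_le q I hf hgs hd ht hR).1⟩ j +
        ∑ i ∈ Finset.range N, (q : ℤ) ^ i * (digits q I (iter q I t i) j : ℤ) := by
  rw [coords_eq_pow_mul_coords_iter_add_sum q I hd ht j N, coords_iter_eq_repr_nearestPlane q I hf hgs hd ht hR]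

/-! ### The finish packaged for an LLL-reduced integer basis of `L(B)` and its reversed dual basis -/

section LLL

variable (B' : Matrix (Fin I.n) (Fin I.n) ℤ) [IsZLattice ℝ (⟨I.n, B'⟩ : LatticeInstance).lattice]

omit [NeZero q] in
/-- The reversed dual basis `(b'^∨_n, …, b'^∨_1)` of another basis `B'` of `L(B)` spans `L(B)*` over `ℤ`.
[cite: Peikert2009, §2.1 (full version p. 7: "D is a basis of Λ*")] -/
theorem span_dualVec_rev_eq (hBL : (⟨I.n, B'⟩ : LatticeInstance).lattice = I.lattice) :
    Submodule.span ℤ (Set.range (⇑(dualVec (⟨I.n, B'⟩ : LatticeInstance)) ∘ Fin.rev)) =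
      dualLattice I.lattice := by
  rw [Fin.rev_surjective.range_comp, ← dualLattice_eq_span_dualVec, hBL]

omit [NeZero q] in
/-- Babai's output in the reversed dual basis of `B'` is a point of `L(B)*`. [cite: Babai1986, §3] -/
theorem vecOf_nearestPlane_dualVec_rev_mem (hBL : (⟨I.n, B'⟩ : LatticeInstance).lattice = I.lattice)
    (x : EuclideanSpace ℝ (Fin I.n)) :
    vecOf (⇑(dualVec (⟨I.n, B'⟩ : LatticeInstance)) ∘ Fin.rev)
        (nearestPlane I.n (⇑(dualVec (⟨I.n, B'⟩ : LatticeInstance)) ∘ Fin.rev) x) ∈ dualLattice I.lattice := by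
  rw [← span_dualVec_rev_eq I B' hBL]
  exact vecOf_mem_span _ _

omit [NeZero q] in
/-- **The Gram–Schmidt norms of the reversed dual of an LLL-reduced basis of `L(B)` dominate `2d/q^{2n}`**
(`d < λ₁(L(B)*)/2`, `q ≥ 2`). [cite: Regev2009, Lemma 3.5 (proof) with Claim 2.13; LenstraLenstraLovasz1982, Prop. 1.12; Peikert2009, Lemma 2.3] -/
theorem div_pow_lt_half_norm_gramSchmidt_dualVec_rev (hBL : (⟨I.n, B'⟩ : LatticeInstance).lattice = I.lattice)
    (hBred : IsLLLReduced (3 / 4) (⟨I.n, B'⟩ : LatticeInstance).vec) (hq : 2 ≤ q)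
    {d : ℝ} (hd0 : 0 ≤ d) (hd : d < minNorm (dualLattice I.lattice) / 2) (i : Fin I.n) :
    d / (q : ℝ) ^ (2 * I.n) < ‖gramSchmidt ℝ (⇑(dualVec (⟨I.n, B'⟩ : LatticeInstance)) ∘ Fin.rev) i‖ / 2 := by
  set J : LatticeInstance := ⟨I.n, B'⟩
  have hJ : J.IsNonsingular := isNonsingular_of_isZLattice J
  have hbI : latticeOfBasis (LatticeInstance.basisOfIsNonsingular hJ) = I.lattice := by
    rw [← hBL, LatticeInstance.lattice_eq_span_basisOfIsNonsingular hJ]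
  have hred : IsLLLReduced (3 / 4) ⇑(LatticeInstance.basisOfIsNonsingular hJ) := by
    rw [LatticeInstance.coe_basisOfIsNonsingular]; exact hBred
  have hbd : ∀ i j, ⟪LatticeInstance.basisOfIsNonsingular hJ i, dualVec J j⟫_ℝ = if i = j then (1 : ℝ) else 0 := by
    intro i j
    have h := inner_zBasis_dualZBasis J i j
    rwa [coe_zBasis, coe_dualZBasis, ← LatticeInstance.coe_basisOfIsNonsingular hJ] at h
  exact div_pow_lt_half_norm_gramSchmidt_dual_rev q I _ hbI hred (dualVec J) hbd hq hd0 hd i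

/-- **Lemma 3.5's output formula with the LLL finish**: for an LLL-reduced basis `B'` of `L(B)`, `q ≥ 2`
and admissible data at distance `d < λ₁(L(B)*)/2`, after `N = 2n` rounds
`a(x) = q^{2n} · (B^∨)^{-1} NearestPlane_{(b'^∨_n,…,b'^∨_1)}(x_{2n}) + Σ_{i<2n} qⁱ (a(x_i) mod q)` — every
quantity on the right is computable in exact rational arithmetic from `x`, the digits and `B'`.
[cite: Regev2009, Lemma 3.5 (proof); Babai1986, §3; LenstraLenstraLovasz1982, Prop. 1.12] -/
theorem coords_eq_of_isLLLReduced [IsZLattice ℝ I.lattice]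
    (hBL : (⟨I.n, B'⟩ : LatticeInstance).lattice = I.lattice)
    (hBred : IsLLLReduced (3 / 4) (⟨I.n, B'⟩ : LatticeInstance).vec) (hq : 2 ≤ q)
    {t : Fin I.n → ℚ} {d : ℝ} (hd : d < minNorm (dualLattice I.lattice) / 2) (ht : Admissible I d t)
    (j : Fin I.n) :
    CVPOracle.coords I (point I t) j =
      (q : ℤ) ^ (2 * I.n) * (dualZBasis I).repr
          ⟨vecOf (⇑(dualVec (⟨I.n, B'⟩ : LatticeInstance)) ∘ Fin.rev)
              (nearestPlane I.n (⇑(dualVec (⟨I.n, B'⟩ : LatticeInstance)) ∘ Fin.rev)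
                (point I (iter q I t (2 * I.n)))),
            vecOf_nearestPlane_dualVec_rev_mem I B' hBL _⟩ j +
        ∑ i ∈ Finset.range (2 * I.n), (q : ℤ) ^ i * (digits q I (iter q I t i) j : ℤ) := by
  set f : Fin I.n → EuclideanSpace ℝ (Fin I.n) := ⇑(dualVec (⟨I.n, B'⟩ : LatticeInstance)) ∘ Fin.rev
  have hlt : ∀ i, d / (q : ℝ) ^ (2 * I.n) < ‖gramSchmidt ℝ f i‖ / 2 :=
    div_pow_lt_half_norm_gramSchmidt_dualVec_rev q I B' hBL hBred hq ht.nonneg hd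
  -- a radius `R` with `d/q^{2n} < R ≤ ‖f̃ᵢ‖/2` for all `i`
  obtain ⟨R, hR, hgs⟩ : ∃ R : ℝ, d / (q : ℝ) ^ (2 * I.n) < R ∧ ∀ i, 2 * R ≤ ‖gramSchmidt ℝ f i‖ := by
    by_cases hn : I.n = 0
    · refine ⟨d / (q : ℝ) ^ (2 * I.n) + 1, by linarith, fun i => ?_⟩
      exact (Fin.elim0 (hn ▸ i : Fin 0) : _)
    · have hne : (Finset.univ : Finset (Fin I.n)).Nonempty :=
        ⟨⟨0, Nat.pos_of_ne_zero hn⟩, Finset.mem_univ _⟩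
      refine ⟨Finset.univ.inf' hne fun i => ‖gramSchmidt ℝ f i‖ / 2, ?_, fun i => ?_⟩
      · exact (Finset.lt_inf'_iff hne).2 fun i _ => hlt i
      · have h := Finset.inf'_le (fun i => ‖gramSchmidt ℝ f i‖ / 2) (Finset.mem_univ i)
        linarith
  have hf : Submodule.span ℤ (Set.range f) = dualLattice I.lattice := span_dualVec_rev_eq I B' hBL
  rw [coords_eq_of_nearestPlane q I hf hgs hd ht hR j]

end LLL

end DigitOracle

end Regev2009

end Literature.Computability.Cryptography

end
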